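import Summits.CriticalPhenomena.Ising3DConformalLimit.Theses.ClusterRigidity
import Summits.CriticalPhenomena.Ising3DConformalLimit.Theorems.EnergyNotSigmaSquaredMoebiusLimitExistsDefs
import HarnessLib
import HarnessLib.Audit

/-!
# Birth skeleton (BC3) for crux `ClusterPointsMoebius` — item stmt-CriticalPhenomena-4657, route `ClusterRigidity`, rank 2

Registered file `Cruxes/ClusterPointsMoebius/Lines/birth.lean` (planner-skel-stmt-CriticalPhenomena-4657-0, 2026-08-17).

THE CRUX (by name `ClusterRigidity.ClusterPointsMoebius`, grounded g13-19, route-review 02360353):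

  `∀ S, (S = 0 off NonCoincident ∧ ∃ u : ℕ → (0,1], u → 0, ∀ n, F_{u k}(n,·) → S n locally uniformly on
      NonCoincident 3 n) → ∃ Δ > 0, IsMoebiusCovariant Δ S`,

where `F_δ(n,x) = ρ★(δ)ⁿ ⟨∏ σ_{⌊xᵢ/δ⌋}⟩_{β_c(3)}` is the SELF-NORMALISED zoom, `ρ★(δ) = ⟨σ₀σ_{⌊δ⁻¹⌋e₀}⟩^{-1/2}`.
The antecedent says exactly: `S` is a NORMALISED CLUSTER POINT OF THE PINNED ZOOM in the sense of the tree's objects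
file `Theorems/EnergyNotSigmaSquaredMoebiusLimitExistsDefs.lean` (`IsNormalised S ∧ IsClusterPoint S`, with
`rhoPin = ρ★` since `⌊1/δ⌋ = ⌊δ⁻¹⌋`, and a `(0,1]`-valued null sequence tends to `0` within `(0,∞)`): this dictionary
is PROVED below (`selfNormalisation_eq_rhoPin`, `isClusterPoint_of_hyp`), so the three stubs are stated over the
existing cluster-point API (`IsClusterPoint`, `IsNormalised`; landed companions `clusterPoint_dilate`,
`pinnedZoomTranslationInvariant`, `clusterPoint_reflectionPositive`, `clusterPoint_nineMirrorRP`, `clusterPoint_cfg01`,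
`isInversionCovariant_of_ge_four`, `Negative/RotationFromInversion`, …) and provers inherit it.

THE LINE (the route's own foreseen split, header "TWO-LAYER PLAN": ClusterPointsMoebius ⇐ {translation + scale
covariance of cluster points, O(3) invariance, inversion covariance}, k = 3) — the SUBSEQUENTIAL twin of the
factorisation 1344 ⟺ 1981 ∧ 1980 ∧ 1982 of route `HyperoctahedralRP` (`MoebiusLimitExists_iff_hrp`), one level down:
cluster points along ONE mesh sequence instead of the full pinned limit.

* STUB A `stub_clusterPoint_scaleCovariant` — KADANOFF COVARIANCE OF CLUSTER POINTS: every normalised cluster point of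
  the pinned zoom is translation invariant, non-degenerate and scale covariant with some `Δ > 0` ("every cluster
  point is a non-degenerate fixed point of the renormalised zoom flow": no RG limit cycle / log-periodic modulation
  along the zoom). For the FULL pinned limit all three clauses are theorems in tree (`Negative/ScaleFree`,
  `ScaleRedundant`, `PinnedRenormalisation`, `ClusterPointTranslation`: Messager–Miracle-Solé + Cauchy's equation),
  because `δ` and `cδ` lie in the same filter; along a SUBSEQUENCE `u_k` this argument is unavailable (`c·u_k ∉ {u_j}`)
  and the clause is the genuine "fixed point, not merely invariant set" content (`clusterPoint_dilate` only moves the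
  cluster SET). Under item 4658 `UniformRegularity` the translation and non-degeneracy clauses are in-tree
  consequences (`pinnedZoomTranslationInvariant`; Reg (c)), so the live content is scale covariance.
* STUB B `stub_clusterPoint_rotationInvariant` — ISOTROPY OF CLUSTER POINTS: a normalised, non-degenerate,
  translation-invariant cluster point that is scale covariant with `Δ > 0` is `O(3)`-invariant. Subsequential twin
  of the PROVED item 1980 `HyperoctahedralRP.LimitRotationInvariant` (`limitRotationInvariant_proof` =
  `HRP2Rigidity_of` ∘ `twoPointKernelOfLimit_proof` ∘ `rotationUpgradeFromTwoPoint_proof`, all typed over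
  `HasPointwiseScalingLimit (criticalCorr 3) ρ S`); every lattice input of that proof (nine-mirror RP, OS positivity,
  two-point window) already has its cluster-point form in tree (`clusterPoint_nineMirrorRP`,
  `clusterPoint_reflectionPositive`), so the expected proof is a re-plumbing of the landed chain from the full filter
  `𝓝[>] 0` to `map u atTop`. Also a COROLLARY of a rotation-free strengthening of STUB C
  (`Negative/RotationFromInversion.isRotationInvariant_of_inversion`: TI + scale + inversion ⇒ O(3), model-blind).
* STUB C `stub_clusterPoint_inversionCovariant` — POLYAKOV UPGRADE FOR CLUSTER POINTS: a normalised, non-degenerate,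
  Euclidean-invariant cluster point that is scale covariant with `Δ > 0` is inversion covariant with the same `Δ`.
  Subsequential twin of the OPEN item 1982 `HyperoctahedralRP.InversionUpgradeNormalised`; the model-blind form is
  FALSE (`Literature.Barriers.CriticalPhenomena.ScaleCovarianceNotMoebius`, free Maxwell `d = 3`), so a proof must use
  the Ising lattice (RP + locality / no `Δ = 2` virial current); orders `0`, odd, `2` are free
  (`isInversionCovariant_of_ge_four`), the content sits at even orders `≥ 4`.

EXACTNESS. Each stub is NECESSARY for the crux (crux ⇒ A: Möbius ⊇ TI + scale, and `S₂ = ‖x−y‖^{-2Δ}·S₂(0,e₀)`,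
`S₂(0,e₀) = 1` by `clusterPoint_cfg01`, gives non-degeneracy; crux ⇒ B: Möbius ⊇ O(3); crux ⇒ C: the Möbius `Δ'`
equals the scale `Δ` at the pair `(0,e₀),(0,2e₀)`), and A ∧ B ∧ C ⇒ crux is the composition below — an exact cut, no
costume (no stub restates the crux or the summit: BC3 probes in the planner folder, 6/6 FAIL).

COMPOSITION (`clusterPointsMoebius_of_pieces`, explicit hypotheses; `ClusterPointsMoebius_of`, the stubs wired in;
no `sorry` of their own): dictionary ⟶ A gives `(TI, ND, Δ, SC)` ⟶ B gives O(3) ⟶ Euclid ⟶ C gives inversion ⟶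
`IsMoebiusCovariant Δ S` is the conjunction.

DISPROOF USED. No `Cruxes/ClusterPointsMoebius/Disproof.lean` exists (crux dir empty at registration). Honoured from
the neighbouring standing disproofs: `Theorems/IsingEuclidUpgradeRefutations.lean`
(`not_inversionUpgrade_of_euclideanLimit` kills the UN-normalised typing only — every stub carries `IsNormalised`);
`Theorems/MoebiusLimitExists/Negative/*` (ScaleFree/ScaleRedundant: scale covariance is free for FULL limits only —
STUB A is stated for subsequential cluster points, where it is not; TwoPointPositivity / PinnedRenormalisation:
non-degeneracy is one bit and automatic for `ρ_pin` in the full-limit case; RotationFromInversion: B ⇐ rotation-free C;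
MoebiusDecoys / StubsNeedLattice: model-blind stubs are refutable — all three stubs keep the lattice clause
`IsClusterPoint` (convergence OF `criticalCorr 3`), none is lattice-blind). No stub is an instance of a landed
`Negative/*` refutation.

Sorries: exactly three, inside `stub_clusterPoint_scaleCovariant`, `stub_clusterPoint_rotationInvariant`,
`stub_clusterPoint_inversionCovariant`.
-/

noncomputable section

open Filter Topology
open Literature.Probability.LatticeModels
open Summit.CriticalPhenomena.Ising3DConformalLimit.MoebiusLimitExistsOnlyInteraction

namespace Summit.CriticalPhenomena.Ising3DConformalLimit.Cruxes.ClusterPointsMoebius.Birth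

open Summit.CriticalPhenomena.Ising3DConformalLimit.Theses

/-! ## Dictionary: the crux's antecedent = normalised cluster point of the pinned zoom -/

/-- The route's self-normalisation `δ ↦ ⟨σ₀σ_{⌊δ⁻¹⌋e₀}⟩^{-1/2}` IS the pinned renormalisation `rhoPin`
(`⌊δ⁻¹⌋ = ⌊1/δ⌋`). [folklore] -/
theorem selfNormalisation_eq_rhoPin :
    (fun δ : ℝ => (criticalTwoPoint 3 (Pi.single 0 ⌊δ⁻¹⌋)) ^ (-(1/2:ℝ))) = rhoPin := by
  funext δ
  simp only [rhoPin, one_div]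

/-- The antecedent of `ClusterPointsMoebius` at `S` (normalised; limit of the self-normalised zoom along a
`(0,1]`-valued null sequence, all `n`, locally uniformly off the diagonals) gives `IsNormalised S ∧ IsClusterPoint S`.
[folklore] -/
theorem isClusterPoint_of_hyp {S : CorrFamily 3}
    (h : (∀ n x, x ∉ NonCoincident 3 n → S n x = 0) ∧ ∃ u : ℕ → ℝ, (∀ k, u k ∈ Set.Ioc (0:ℝ) 1) ∧
      Tendsto u atTop (nhds 0) ∧ ∀ n, TendstoLocallyUniformlyOn
        (fun k => rescaledCorrelator (criticalCorr 3)
          (fun δ : ℝ => (criticalTwoPoint 3 (Pi.single 0 ⌊δ⁻¹⌋)) ^ (-(1/2:ℝ))) n (u k))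
        (S n) atTop (NonCoincident 3 n)) :
    IsNormalised S ∧ IsClusterPoint S := by
  obtain ⟨hnorm, u, hu01, hu0, hconv⟩ := h
  refine ⟨hnorm, u, ?_, ?_⟩
  · exact tendsto_nhdsWithin_iff.2 ⟨hu0, Eventually.of_forall fun k => (hu01 k).1⟩
  · intro n
    rw [← selfNormalisation_eq_rhoPin]
    exact hconv n

/-! ## The three registered stubs -/

/-- **STUB A — Kadanoff covariance of cluster points (scale part of item 4657; subsequential twin of item 1981's
covariance clauses).** Every normalised cluster point `S` of the pinned critical zoom on `ℤ³` is translation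
invariant, has non-degenerate two-point function, and is scale covariant with some `Δ > 0`: cluster points are
non-degenerate FIXED POINTS of the renormalised zoom flow `S ↦ (t^{nΔ} S_n(t·))`, not merely an invariant set
(`clusterPoint_dilate`). Free for the full pinned limit (Messager–Miracle-Solé + Cauchy: `Negative/ScaleFree`),
open along a subsequence ("no RG limit cycle on the zoom", Duminil-Copin ICM 2022 §8.4 p. 29); under item 4658 the
translation / non-degeneracy clauses are in tree (`pinnedZoomTranslationInvariant`, Reg (c)).
[cite: DuminilCopinICM2022, §8.1 eq. (8.1)–(8.2) and §8.4 p. 29] -/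
theorem stub_clusterPoint_scaleCovariant :
    ∀ S : CorrFamily 3, IsClusterPoint S → IsNormalised S →
      IsTranslationInvariant S ∧ IsNondegenerateTwoPoint S ∧ ∃ Δ : ℝ, 0 < Δ ∧ IsScaleCovariant Δ S := by
  sorry

/-- **STUB B — isotropy of cluster points (O(3) part of item 4657; subsequential twin of the PROVED item 1980
`HyperoctahedralRP.LimitRotationInvariant`).** A normalised, non-degenerate, translation-invariant cluster point of
the pinned critical zoom that is scale covariant with `Δ > 0` is invariant under every linear isometry of `ℝ³`
(reflections included). Expected proof: re-plumb `limitRotationInvariant_proof` (HRP2Rigidity ∘ two-point kernel ∘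
rotation upgrade) from `𝓝[>] 0` to one mesh sequence, its lattice inputs having cluster-point forms in tree
(`clusterPoint_nineMirrorRP`, `clusterPoint_reflectionPositive`). Rotation invariance on `ℤ³` is otherwise only
postulated (Duminil-Copin ICM 2022 §8.1 p. 25). [cite: DuminilCopinICM2022, §8.1 p. 25] -/
theorem stub_clusterPoint_rotationInvariant :
    ∀ (Δ : ℝ) (S : CorrFamily 3), IsClusterPoint S → IsNormalised S → IsNondegenerateTwoPoint S →
      IsTranslationInvariant S → 0 < Δ → IsScaleCovariant Δ S → IsRotationInvariant S := by
  sorry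

/-- **STUB C — Polyakov's inversion upgrade for cluster points (inversion part of item 4657; subsequential twin of
the OPEN item 1982 `HyperoctahedralRP.InversionUpgradeNormalised`).** A normalised, non-degenerate,
Euclidean-invariant cluster point of the pinned critical zoom that is scale covariant with `Δ > 0` is covariant under
the unit inversion with the same `Δ`. The model-blind statement is FALSE (free Maxwell field in `d = 3`,
El-Showk–Nakayama–Rychkov 2011; tree barrier `ScaleCovarianceNotMoebius`), so the lattice clause `IsClusterPoint`
(reflection positivity + locality of Ising₃, absence of a dimension-2 virial current) must be used; orders `0`,
odd and `2` are free (`isInversionCovariant_of_ge_four`). [cite: PolandRychkovVichi2019, §II eq. (2)] -/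
theorem stub_clusterPoint_inversionCovariant :
    ∀ (Δ : ℝ) (S : CorrFamily 3), IsClusterPoint S → IsNormalised S → IsNondegenerateTwoPoint S →
      IsEuclideanInvariant S → 0 < Δ → IsScaleCovariant Δ S → IsInversionCovariant Δ S := by
  sorry

/-! ## The composition -/

/-- **A ∧ B ∧ C ⇒ the crux, pointwise in `S`** — the three stub signatures as explicit hypotheses; the conclusion is
the body of `ClusterPointsMoebius` at `S`. Dictionary, then A gives `(TI, ND, Δ, scale)`, B gives `O(3)`, hence
Euclidean invariance, C gives inversion covariance; `IsMoebiusCovariant Δ S` is the conjunction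
(Di Francesco–Mathieu–Sénéchal 1997 §4.3.1 eq. (4.62)). No `sorry`. [cite: FrancescoMathieuSenechal1997, §4.3.1 eq. (4.62)] -/
theorem clusterPointsMoebius_of_pieces
    (hA : ∀ S : CorrFamily 3, IsClusterPoint S → IsNormalised S →
      IsTranslationInvariant S ∧ IsNondegenerateTwoPoint S ∧ ∃ Δ : ℝ, 0 < Δ ∧ IsScaleCovariant Δ S)
    (hB : ∀ (Δ : ℝ) (S : CorrFamily 3), IsClusterPoint S → IsNormalised S → IsNondegenerateTwoPoint S →
      IsTranslationInvariant S → 0 < Δ → IsScaleCovariant Δ S → IsRotationInvariant S)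
    (hC : ∀ (Δ : ℝ) (S : CorrFamily 3), IsClusterPoint S → IsNormalised S → IsNondegenerateTwoPoint S →
      IsEuclideanInvariant S → 0 < Δ → IsScaleCovariant Δ S → IsInversionCovariant Δ S)
    (S : CorrFamily 3)
    (h : (∀ n x, x ∉ NonCoincident 3 n → S n x = 0) ∧ ∃ u : ℕ → ℝ, (∀ k, u k ∈ Set.Ioc (0:ℝ) 1) ∧
      Tendsto u atTop (nhds 0) ∧ ∀ n, TendstoLocallyUniformlyOn
        (fun k => rescaledCorrelator (criticalCorr 3)
          (fun δ : ℝ => (criticalTwoPoint 3 (Pi.single 0 ⌊δ⁻¹⌋)) ^ (-(1/2:ℝ))) n (u k))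
        (S n) atTop (NonCoincident 3 n)) :
    ∃ Δ : ℝ, 0 < Δ ∧ IsMoebiusCovariant Δ S := by
  obtain ⟨hN, hcp⟩ := isClusterPoint_of_hyp h
  obtain ⟨htr, hnd, Δ, hΔ, hsc⟩ := hA S hcp hN
  have hrot : IsRotationInvariant S := hB Δ S hcp hN hnd htr hΔ hsc
  have heuc : IsEuclideanInvariant S := ⟨htr, hrot⟩
  exact ⟨Δ, hΔ, heuc, hsc, hC Δ S hcp hN hnd heuc hΔ hsc⟩

/-- **THE SKELETON THEOREM** — concludes the crux `ClusterRigidity.ClusterPointsMoebius` BY NAME from the three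
registered stubs (through `clusterPointsMoebius_of_pieces`). [folklore] -/
theorem ClusterPointsMoebius_of : ClusterRigidity.ClusterPointsMoebius :=
  fun S h => clusterPointsMoebius_of_pieces stub_clusterPoint_scaleCovariant
    stub_clusterPoint_rotationInvariant stub_clusterPoint_inversionCovariant S h

end Summit.CriticalPhenomena.Ising3DConformalLimit.Cruxes.ClusterPointsMoebius.Birth

end
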